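import Summits.AtomisticToContinuum.Crystallization.Theorems.HolmgrenBoyleLindHalfSpaceUniqueContinuationTransverseBlaschke
import Summits.AtomisticToContinuum.Crystallization.Theorems.HolmgrenBoyleLindUCContinuum

/-!
# Route `HolmgrenBoyleLind`: Lennard-Jones force fields of separated sources, part 6 —
unique continuation from thick normal lines; grids
Support file for the crux item stmt-AtomisticToContinuum-6075 (`HalfSpaceUniqueContinuation`, line
`registered`: infrastructure for its unique-continuation cores `stub_ucRank0/1/2`, written by a
stub-worker of lead c1), continuing `HolmgrenBoyleLindHalfSpaceUniqueContinuationTransverseBlaschke.lean`.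
A closed sub-class of the crux, valid in every period rank and using no periodicity:

* `hbl_eq_of_thick_normal_lines` — two `δ`-separated sets in exact Lennard-Jones force balance
  agreeing on `{⟪z, u⟫ < a}` are EQUAL as soon as the normal line through every defect carries a
  non-Blaschke sequence of points of `ω` below the plane: lowest defect `y₀` on the line, `Φ = 0`
  at the observers (`hbl_diffField_eq_zero_on_halfSpace`), on the open normal ray
  (`hbl_inner_field_eq_zero_on_normal_ray`), up to `y₀` along the clean segment
  (`hbl_inner_field_eq_zero_on_line`), against the `‖·‖⁻¹³` blow-up at `y₀`
  (`hbl_field_ne_zero_near_source`);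
* `hbl_thick_of_bounded_gaps` — rows with bounded gaps (Delone rows) are thick;
* `hbl_eq_of_agree_of_grid` — GRIDS: two separated balanced product sets `E₁ × E₂ × E₃`,
  `E₁' × E₂' × E₃'` with `E₁, E₁'` relatively dense in `ℝ`, agreeing on `{z₀ < a}`, are equal.
All `[folklore]`; nothing here closes an item.
-/

noncomputable section
namespace Summit.AtomisticToContinuum.Crystallization.Theorems.HolmgrenBoyleLind

open scoped BigOperators Topology InnerProductSpace
open Literature.MathematicalPhysics.StatisticalMechanics
open Summit.AtomisticToContinuum.Crystallization.Theorems

local notation "𝔼" => EuclideanSpace ℝ (Fin 3)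

/-- **Unique continuation from thick normal lines.** Let `ω, ω' ⊂ ℝ³` be `δ`-separated, both in
exact Lennard-Jones force balance, agreeing on the open half-space `{⟪z, u⟫ < a}` (`u` a unit
vector). Suppose that through every defect `x ∈ ω ∆ ω'` the normal line `x − ℝ u` is THICK below
the plane: it carries points `x − tₙ u ∈ ω` with `tₙ ≥ ⟪x, u⟫ − a + 2` injective and
`Σ 1/tₙ = ∞` (e.g. a row of `ω` with bounded gaps). Then `ω = ω'`. Proof: at the lowest defect
`y₀` of the normal line through any defect, the difference field `Φ` vanishes at the observers
(`hbl_diffField_eq_zero_on_halfSpace`), hence on the open normal ray below the plane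
(`hbl_inner_field_eq_zero_on_normal_ray`), hence — the segment up to `y₀` being free of sources —
up to `y₀` (`hbl_inner_field_eq_zero_on_line`), contradicting the `‖·‖⁻¹³` blow-up at `y₀`
(`hbl_field_ne_zero_near_source`). It needs no periodicity; with `hbl_thick_of_bounded_gaps`
it closes unique continuation across axis half-spaces for grids (`hbl_eq_of_agree_of_grid`).
[folklore] -/
theorem hbl_eq_of_thick_normal_lines :
    ∀ (ω ω' : Set (EuclideanSpace ℝ (Fin 3))) (δ : ℝ), 0 < δ →
      (∀ a ∈ ω, ∀ b ∈ ω, a ≠ b → δ ≤ dist a b) →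
      (∀ a ∈ ω', ∀ b ∈ ω', a ≠ b → δ ≤ dist a b) →
      (∀ x ∈ ω, HasSum (fun y : {y : EuclideanSpace ℝ (Fin 3) // y ∈ ω ∧ y ≠ x} =>
        (deriv lennardJones (dist x y) / dist x y) • (x - (y : EuclideanSpace ℝ (Fin 3)))) 0) →
      (∀ x ∈ ω', HasSum (fun y : {y : EuclideanSpace ℝ (Fin 3) // y ∈ ω' ∧ y ≠ x} =>
        (deriv lennardJones (dist x y) / dist x y) • (x - (y : EuclideanSpace ℝ (Fin 3)))) 0) →
      ∀ (u : EuclideanSpace ℝ (Fin 3)) (a : ℝ), ‖u‖ = 1 →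
      (∀ z : EuclideanSpace ℝ (Fin 3), inner ℝ z u < a → (z ∈ ω ↔ z ∈ ω')) →
      (∀ x : EuclideanSpace ℝ (Fin 3), ¬ (x ∈ ω ↔ x ∈ ω') → ∃ t : ℕ → ℝ,
        (∀ n : ℕ, inner ℝ x u - a + 2 ≤ t n) ∧ Function.Injective t ∧
        ¬ Summable (fun n : ℕ => (t n)⁻¹) ∧ ∀ n : ℕ, x - t n • u ∈ ω) →
      ω = ω' := by
  intro ω ω' δ hδ hsep hsep' hbal hbal' u a hu hagree hthick
  classical
  by_contra hne
  obtain ⟨x₀, hx₀⟩ : ∃ x₀ : 𝔼, ¬ (x₀ ∈ ω ↔ x₀ ∈ ω') := by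
    by_contra h
    push Not at h
    exact hne (Set.ext h)
  have hu0 : u ≠ 0 := norm_ne_zero_iff.1 (by rw [hu]; exact one_ne_zero)
  have hsepp : ∀ a ∈ ({y : 𝔼 | y ∈ ω ∧ y ∉ ω'} : Set 𝔼), ∀ b ∈ ({y : 𝔼 | y ∈ ω ∧ y ∉ ω'} : Set 𝔼),
      a ≠ b → δ ≤ dist a b := fun a ha b hb hab => hsep a ha.1 b hb.1 hab
  have hsepm : ∀ a ∈ ({y : 𝔼 | y ∈ ω' ∧ y ∉ ω} : Set 𝔼), ∀ b ∈ ({y : 𝔼 | y ∈ ω' ∧ y ∉ ω} : Set 𝔼),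
      a ≠ b → δ ≤ dist a b := fun a ha b hb hab => hsep' a ha.1 b hb.1 hab
  have hdef : ∀ z : 𝔼, ¬ (z ∈ ω ↔ z ∈ ω') ↔
      z ∈ ({y : 𝔼 | y ∈ ω ∧ y ∉ ω'} : Set 𝔼) ∪ {y : 𝔼 | y ∈ ω' ∧ y ∉ ω} := by
    intro z
    simp only [Set.mem_union, Set.mem_setOf_eq]
    tauto
  have hlev : ∀ z : 𝔼, ¬ (z ∈ ω ↔ z ∈ ω') → a ≤ ⟪z, u⟫_ℝ := by
    intro z hz
    by_contra h
    push Not at h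
    exact hz (hagree z h)
  -- the defects on the normal line through `x₀`, at or below `x₀`
  set D : Set ℝ := {σ : ℝ | 0 ≤ σ ∧ ¬ (x₀ - σ • u ∈ ω ↔ x₀ - σ • u ∈ ω')} with hD
  have hDfin : D.Finite := by
    have hfinj : Function.Injective (fun σ : ℝ => x₀ - σ • u) := fun σ τ h =>
      smul_left_injective ℝ hu0 (sub_right_injective h)
    set b : ℝ := ⟪x₀, u⟫_ℝ - a with hb
    have h1 := (hbl_finite_near hδ hsep x₀ b).preimage hfinj.injOn
    have h2 := (hbl_finite_near hδ hsep' x₀ b).preimage hfinj.injOn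
    refine (h1.union h2).subset ?_
    rintro σ ⟨hσ0, hσd⟩
    have hσb : σ ≤ b := by
      have h := hlev _ hσd
      rw [inner_sub_left, real_inner_smul_left, real_inner_self_eq_norm_sq, hu] at h
      rw [hb]
      linarith
    have hdist : dist (x₀ - σ • u) x₀ ≤ b := by
      rw [dist_eq_norm, sub_sub_cancel_left, norm_neg, norm_smul, Real.norm_eq_abs, hu, mul_one,
        abs_of_nonneg hσ0]
      exact hσb
    by_cases hω : x₀ - σ • u ∈ ω
    · exact Or.inl ⟨hω, hdist⟩
    · have hω' : x₀ - σ • u ∈ ω' := by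
        by_contra h'
        exact hσd ⟨fun h => (hω h).elim, fun h => (h' h).elim⟩
      exact Or.inr ⟨hω', hdist⟩
  have h0D : (0 : ℝ) ∈ D := ⟨le_rfl, by simpa using hx₀⟩
  obtain ⟨σs, hσs, hmax⟩ := Set.exists_max_image D id hDfin ⟨0, h0D⟩
  -- the lowest defect `y₀` on the line; beyond it the line is clean
  set y₀ : 𝔼 := x₀ - σs • u with hy₀
  have hy₀d : ¬ (y₀ ∈ ω ↔ y₀ ∈ ω') := hσs.2
  have hclean : ∀ τ : ℝ, σs < τ → (x₀ - τ • u ∈ ω ↔ x₀ - τ • u ∈ ω') := by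
    intro τ hτ
    by_contra h
    exact (not_le.2 hτ) (hmax τ ⟨hσs.1.trans hτ.le, h⟩)
  -- the thick sequence at `y₀`, the base point `p` and the direction `v = -u`
  obtain ⟨t, ht, hinj, hsum, htω⟩ := hthick y₀ hy₀d
  set c : ℝ := ⟪y₀, u⟫_ℝ - a with hc
  have hc0 : 0 ≤ c := by
    have h := hlev y₀ hy₀d
    rw [hc]
    linarith
  set p : 𝔼 := y₀ - (c + 1) • u with hp
  set v : 𝔼 := -u with hv
  have hvn : ‖v‖ = 1 := by rw [hv, norm_neg, hu]
  have hv0 : v ≠ 0 := norm_ne_zero_iff.1 (by rw [hvn]; exact one_ne_zero)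
  have hpu : ⟪p, u⟫_ℝ = a - 1 := by
    rw [hp, inner_sub_left, real_inner_smul_left, real_inner_self_eq_norm_sq, hu, hc]
    ring
  have hmargin : ∀ y : 𝔼, ¬ (y ∈ ω ↔ y ∈ ω') → (1 : ℝ) ≤ ⟪p - y, v⟫_ℝ := by
    intro y hy
    have h1 : ⟪p - y, v⟫_ℝ = ⟪y, u⟫_ℝ - ⟪p, u⟫_ℝ := by
      rw [hv, inner_neg_right, inner_sub_left]
      ring
    rw [h1, hpu]
    linarith [hlev y hy]
  have hclp : ∀ y ∈ ({y : 𝔼 | y ∈ ω ∧ y ∉ ω'} : Set 𝔼), (1 : ℝ) ≤ ⟪p - y, v⟫_ℝ :=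
    fun y hy => hmargin y ((hdef y).2 (Or.inl hy))
  have hclm : ∀ y ∈ ({y : 𝔼 | y ∈ ω' ∧ y ∉ ω} : Set 𝔼), (1 : ℝ) ≤ ⟪p - y, v⟫_ℝ :=
    fun y hy => hmargin y ((hdef y).2 (Or.inr hy))
  have hline : ∀ s : ℝ, p + s • v = x₀ - (σs + (c + 1) + s) • u := by
    intro s
    simp only [hp, hv, hy₀, smul_neg, add_smul]
    abel
  -- the zeros of `Φ` on the ray: `s_n = t_n - c - 1 ≥ 1`
  set s' : ℕ → ℝ := fun n => t n - (c + 1) with hs'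
  have hs'1 : ∀ n, 1 ≤ s' n := fun n => by
    simp only [hs']
    linarith [ht n]
  have hs'inj : Function.Injective s' := by
    intro m n h
    apply hinj
    simp only [hs'] at h
    linarith
  have hs'sum : ¬ Summable (fun n => (s' n)⁻¹) := by
    intro h
    refine hsum (Summable.of_nonneg_of_le (fun n => ?_) (fun n => ?_) h)
    · exact inv_nonneg.2 (by linarith [ht n, hc0])
    · refine (inv_le_inv₀ (by linarith [ht n, hc0]) (by linarith [hs'1 n])).2 ?_
      simp only [hs']
      linarith
  have hobs : ∀ n, p + s' n • v = y₀ - t n • u := by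
    intro n
    simp only [hp, hv, hs', smul_neg, sub_smul, add_smul]
    abel
  have hΦ0 : ∀ n,
      (∑' y : ({y : 𝔼 | y ∈ ω ∧ y ∉ ω'} : Set 𝔼),
          (deriv lennardJones (dist (p + s' n • v) y) / dist (p + s' n • v) y) •
            (p + s' n • v - (y : 𝔼))) -
        (∑' y : ({y : 𝔼 | y ∈ ω' ∧ y ∉ ω} : Set 𝔼),
          (deriv lennardJones (dist (p + s' n • v) y) / dist (p + s' n • v) y) •
            (p + s' n • v - (y : 𝔼))) = 0 := by
    intro n
    rw [hobs n]
    have hin : ⟪y₀ - t n • u, u⟫_ℝ < a := by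
      rw [inner_sub_left, real_inner_smul_left, real_inner_self_eq_norm_sq, hu]
      have h := ht n
      rw [hc] at h
      linarith
    exact hbl_diffField_eq_zero_on_halfSpace hδ hsep hsep' hbal hbal' hagree _ (htω n) hin
  -- Blaschke along the ray: `Φ = 0` on the open ray `σ > 0`
  have hray : ∀ (e : 𝔼) (σ : ℝ), 0 < σ →
      ⟪e, (∑' y : ({y : 𝔼 | y ∈ ω ∧ y ∉ ω'} : Set 𝔼),
          (deriv lennardJones (dist (p + σ • v) y) / dist (p + σ • v) y) •
            (p + σ • v - (y : 𝔼))) -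
        (∑' y : ({y : 𝔼 | y ∈ ω' ∧ y ∉ ω} : Set 𝔼),
          (deriv lennardJones (dist (p + σ • v) y) / dist (p + σ • v) y) •
            (p + σ • v - (y : 𝔼)))⟫_ℝ = 0 := by
    intro e
    exact hbl_inner_field_eq_zero_on_normal_ray _ _ _ _ hδ one_pos hsepp hsepm p v e hvn hclp hclm _ hs'1
      hs'inj hs'sum (fun n => by rw [hΦ0 n, inner_zero_right])
  -- blow-up near the source `y₀`
  have hy₀mem : y₀ ∈ ({y : 𝔼 | y ∈ ω ∧ y ∉ ω'} : Set 𝔼) ∪ {y : 𝔼 | y ∈ ω' ∧ y ∉ ω} :=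
    (hdef y₀).1 hy₀d
  obtain ⟨ε, hε, hne0⟩ : ∃ ε : ℝ, 0 < ε ∧ ∀ x : 𝔼, dist x y₀ < ε → x ≠ y₀ →
      (∑' y : ({y : 𝔼 | y ∈ ω ∧ y ∉ ω'} : Set 𝔼),
          (deriv lennardJones (dist x y) / dist x y) • (x - (y : 𝔼))) -
        (∑' y : ({y : 𝔼 | y ∈ ω' ∧ y ∉ ω} : Set 𝔼),
          (deriv lennardJones (dist x y) / dist x y) • (x - (y : 𝔼))) ≠ 0 := by
    rcases hy₀mem with hyp | hym
    · exact hbl_field_ne_zero_near_source hδ hsepp hsepm (fun y hy hy' => hy.2 hy'.1) hyp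
    · obtain ⟨ε, hε, h⟩ :=
        hbl_field_ne_zero_near_source hδ hsepm hsepp (fun y hy hy' => hy.2 hy'.1) hym
      refine ⟨ε, hε, fun x hx hxy h0 => h x hx hxy ?_⟩
      rw [← neg_sub, h0, neg_zero]
  -- the test point `x₁ = p + σ₁ v` at distance `ε₁` below `y₀` on the line
  set ε₁ : ℝ := min ε 1 / 2 with hε₁
  have hε₁0 : 0 < ε₁ := by
    rw [hε₁]
    exact half_pos (lt_min hε one_pos)
  have hε₁ε : ε₁ < ε := by
    rw [hε₁]
    linarith [min_le_left ε 1]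
  have hε₁1 : ε₁ < 1 := by
    rw [hε₁]
    linarith [min_le_right ε 1]
  set σ₁ : ℝ := -(c + 1) + ε₁ with hσ₁
  have hx₁ : p + σ₁ • v - y₀ = ε₁ • v := by
    simp only [hp, hv, hσ₁, smul_neg, add_smul, neg_smul]
    abel
  have hdist : dist (p + σ₁ • v) y₀ = ε₁ := by
    rw [dist_eq_norm, hx₁, norm_smul, hvn, mul_one, Real.norm_eq_abs, abs_of_pos hε₁0]
  have hne1 : p + σ₁ • v ≠ y₀ := by
    intro h
    rw [h, dist_self] at hdist
    exact hε₁0.ne hdist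
  -- the segment `σ ∈ [σ₁ - ε₁/2, 2]` of the line is free of sources, hence uniformly clear
  have hsegclean : ∀ σ : ℝ, σ₁ - ε₁ / 2 ≤ σ →
      p + σ • v ∉ ({y : 𝔼 | y ∈ ω ∧ y ∉ ω'} : Set 𝔼) ∪ {y : 𝔼 | y ∈ ω' ∧ y ∉ ω} := by
    intro σ hσ hmem
    have hd' := (hdef _).2 hmem
    rw [hline σ] at hd'
    have hτ : σs < σs + (c + 1) + σ := by
      rw [hσ₁] at hσ
      linarith
    exact hd' (hclean _ hτ)
  have hXc : IsClosed (({y : 𝔼 | y ∈ ω ∧ y ∉ ω'} : Set 𝔼) ∪ {y : 𝔼 | y ∈ ω' ∧ y ∉ ω}) :=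
    (Metric.isClosed_of_pairwise_le_dist hδ hsepp).union
      (Metric.isClosed_of_pairwise_le_dist hδ hsepm)
  obtain ⟨ρ, hρ, hclear⟩ : ∃ ρ : ℝ, 0 < ρ ∧ ∀ σ ∈ Set.Icc (σ₁ - ε₁ / 2) 2,
      ∀ y ∈ ({y : 𝔼 | y ∈ ω ∧ y ∉ ω'} : Set 𝔼) ∪ {y : 𝔼 | y ∈ ω' ∧ y ∉ ω},
        ρ ≤ ‖p + σ • v - y‖ := by
    have hγ : Continuous fun σ : ℝ => p + σ • v := by fun_prop
    have hcont : Continuous fun σ : ℝ => Metric.infDist (p + σ • v)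
        (({y : 𝔼 | y ∈ ω ∧ y ∉ ω'} : Set 𝔼) ∪ {y : 𝔼 | y ∈ ω' ∧ y ∉ ω}) :=
      (Metric.continuous_infDist_pt _).comp hγ
    have hpos : ∀ σ ∈ Set.Icc (σ₁ - ε₁ / 2) 2, 0 < Metric.infDist (p + σ • v)
        (({y : 𝔼 | y ∈ ω ∧ y ∉ ω'} : Set 𝔼) ∪ {y : 𝔼 | y ∈ ω' ∧ y ∉ ω}) :=
      fun σ hσ => (hXc.notMem_iff_infDist_pos ⟨y₀, hy₀mem⟩).1 (hsegclean σ hσ.1)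
    obtain ⟨ρ, hρ, hle⟩ := isCompact_Icc.exists_forall_le' hcont.continuousOn hpos
    refine ⟨ρ, hρ, fun σ hσ y hy => (hle σ hσ).trans ?_⟩
    rw [← dist_eq_norm]
    exact Metric.infDist_le_dist_of_mem hy
  -- identity theorem along the line, from the ray `σ > 0` down to `σ₁`
  have hcomp : ∀ e : 𝔼,
      ⟪e, (∑' y : ({y : 𝔼 | y ∈ ω ∧ y ∉ ω'} : Set 𝔼),
          (deriv lennardJones (dist (p + σ₁ • v) y) / dist (p + σ₁ • v) y) •
            (p + σ₁ • v - (y : 𝔼))) -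
        (∑' y : ({y : 𝔼 | y ∈ ω' ∧ y ∉ ω} : Set 𝔼),
          (deriv lennardJones (dist (p + σ₁ • v) y) / dist (p + σ₁ • v) y) •
            (p + σ₁ • v - (y : 𝔼)))⟫_ℝ = 0 := by
    intro e
    refine hbl_inner_field_eq_zero_on_line hδ hρ (half_pos hρ) hsepp hsepm p v e
      (a₁ := σ₁ - ε₁ / 2) (a₂ := 2)
      (fun y hy σ h1 h2 => hclear σ ⟨h1, h2⟩ y (Or.inl hy))
      (fun y hy σ h1 h2 => hclear σ ⟨h1, h2⟩ y (Or.inr hy))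
      (by rw [hvn, mul_one]) (t₀ := 1) ⟨by linarith, by norm_num⟩ ?_ σ₁ ⟨by linarith, by linarith⟩
    filter_upwards [Ioi_mem_nhds (zero_lt_one' ℝ)] with σ hσ using hray e σ hσ
  have hzero1 :
      (∑' y : ({y : 𝔼 | y ∈ ω ∧ y ∉ ω'} : Set 𝔼),
          (deriv lennardJones (dist (p + σ₁ • v) y) / dist (p + σ₁ • v) y) •
            (p + σ₁ • v - (y : 𝔼))) -
        (∑' y : ({y : 𝔼 | y ∈ ω' ∧ y ∉ ω} : Set 𝔼),
          (deriv lennardJones (dist (p + σ₁ • v) y) / dist (p + σ₁ • v) y) •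
            (p + σ₁ • v - (y : 𝔼))) = 0 :=
    inner_self_eq_zero.1 (hcomp _)
  exact hne0 _ (by rw [hdist]; exact hε₁ε) hne1 hzero1

/-- **Rows with bounded gaps are thick.** If beyond `T₀` every window `[T, T + L]` of the normal
line `x − ℝ u` contains a point `x − τ u ∈ ω`, then the line carries an injective sequence
`x − tₙ u ∈ ω`, `tₙ ≥ T₀`, with `Σ 1/tₙ = ∞` (one point per window
`[T₁ + n(L+1), T₁ + n(L+1) + L]`, `T₁ = max T₀ 1`; harmonic comparison). This is the form in
which `hbl_eq_of_thick_normal_lines` applies to rows of a Delone set. [folklore] -/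
theorem hbl_thick_of_bounded_gaps {ω : Set 𝔼} {x u : 𝔼} {T₀ L : ℝ} (hL : 0 ≤ L)
    (hrow : ∀ T : ℝ, T₀ ≤ T → ∃ τ : ℝ, T ≤ τ ∧ τ ≤ T + L ∧ x - τ • u ∈ ω) :
    ∃ t : ℕ → ℝ, (∀ n, T₀ ≤ t n) ∧ Function.Injective t ∧
      ¬ Summable (fun n => (t n)⁻¹) ∧ ∀ n, x - t n • u ∈ ω := by
  set T₁ : ℝ := max T₀ 1 with hT₁
  have hT₀ : T₀ ≤ T₁ := le_max_left _ _
  have hT1 : 1 ≤ T₁ := le_max_right _ _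
  have hwin : ∀ n : ℕ, ∃ τ : ℝ, T₁ + n * (L + 1) ≤ τ ∧ τ ≤ T₁ + n * (L + 1) + L ∧ x - τ • u ∈ ω :=
    fun n => hrow _ (hT₀.trans (le_add_of_nonneg_right (by positivity)))
  choose t ht1 ht2 ht3 using hwin
  refine ⟨t, fun n => hT₀.trans ((le_add_of_nonneg_right (by positivity)).trans (ht1 n)), ?_, ?_, ht3⟩
  · intro m n h
    by_contra hmn
    rcases lt_or_gt_of_ne hmn with hlt | hlt
    · have h1 : (m : ℝ) + 1 ≤ n := by exact_mod_cast hlt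
      have h2 := ht2 m
      have h3 := ht1 n
      rw [h] at h2
      nlinarith
    · have h1 : (n : ℝ) + 1 ≤ m := by exact_mod_cast hlt
      have h2 := ht2 n
      have h3 := ht1 m
      rw [← h] at h2
      nlinarith
  · intro hs
    have hc : 0 < T₁ + L + 1 := by linarith
    have hle : ∀ n : ℕ, (T₁ + L + 1)⁻¹ * ((n + 1 : ℕ) : ℝ)⁻¹ ≤ (t n)⁻¹ := by
      intro n
      have htn : 0 < t n := by
        have := ht1 n
        have : (0 : ℝ) ≤ n * (L + 1) := by positivity
        linarith
      rw [← mul_inv, inv_le_inv₀ (by positivity) htn]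
      have h2 := ht2 n
      push_cast
      nlinarith
    have hs' : Summable (fun n : ℕ => (T₁ + L + 1)⁻¹ * ((n + 1 : ℕ) : ℝ)⁻¹) :=
      Summable.of_nonneg_of_le (fun n => by positivity) hle hs
    have hs'' : Summable (fun n : ℕ => ((n + 1 : ℕ) : ℝ)⁻¹) := by
      have h := hs'.mul_left (T₁ + L + 1)
      refine h.congr fun n => ?_
      field_simp
    exact Real.not_summable_natCast_inv ((summable_nat_add_iff 1).1 hs'')

/-- **Unique continuation for grids (closed sub-class, all ranks).** Two `δ`-separated product
sets `ω = E₁ × E₂ × E₃`, `ω' = E₁' × E₂' × E₃'` (coordinates of `ℝ³`) in exact Lennard-Jones force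
balance, with `E₁, E₁'` relatively dense in `ℝ`, that agree on the open half-space `{z₀ < a}` are
EQUAL: every defect `(ξ, η, ζ)` has `η ∈ E₂`, `ζ ∈ E₃` (test the point `(e, η, ζ)`, `e ∈ E₁'`,
`e < a`), so its normal row `{(ξ − τ, η, ζ)}` meets `ω` in `E₁ × {η} × {ζ}`, which has bounded
gaps (`hbl_thick_of_bounded_gaps`), and `hbl_eq_of_thick_normal_lines` applies. With
`E₃ = T ℤ + c` and `E₁, E₂` aperiodic Delone FLC sets these are the rank-ONE grids
`D₁ × D₂ × ℤ t₀` of the module docstring (their patch-hull elements are again such products);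
with `E₃` aperiodic they have rank zero, with `E₁` or `E₂` periodic rank two or three — no
periodicity is used. [folklore] -/
theorem hbl_eq_of_agree_of_grid {ω ω' : Set 𝔼} {δ r₁ : ℝ} (hδ : 0 < δ) (hr₁ : 0 ≤ r₁)
    (hsep : ∀ a ∈ ω, ∀ b ∈ ω, a ≠ b → δ ≤ dist a b)
    (hsep' : ∀ a ∈ ω', ∀ b ∈ ω', a ≠ b → δ ≤ dist a b)
    (hbal : ∀ x ∈ ω, HasSum (fun y : {y : 𝔼 // y ∈ ω ∧ y ≠ x} =>
      (deriv lennardJones (dist x y) / dist x y) • (x - (y : 𝔼))) 0)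
    (hbal' : ∀ x ∈ ω', HasSum (fun y : {y : 𝔼 // y ∈ ω' ∧ y ≠ x} =>
      (deriv lennardJones (dist x y) / dist x y) • (x - (y : 𝔼))) 0)
    {E₁ E₂ E₃ E₁' E₂' E₃' : Set ℝ}
    (hω : ∀ z : 𝔼, z ∈ ω ↔ z 0 ∈ E₁ ∧ z 1 ∈ E₂ ∧ z 2 ∈ E₃)
    (hω' : ∀ z : 𝔼, z ∈ ω' ↔ z 0 ∈ E₁' ∧ z 1 ∈ E₂' ∧ z 2 ∈ E₃')
    (hE₁ : ∀ c : ℝ, ∃ e ∈ E₁, |e - c| ≤ r₁) (hE₁' : ∀ c : ℝ, ∃ e ∈ E₁', |e - c| ≤ r₁)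
    {a : ℝ} (hagree : ∀ z : 𝔼, z 0 < a → (z ∈ ω ↔ z ∈ ω')) : ω = ω' := by
  set u : 𝔼 := EuclideanSpace.single (0 : Fin 3) (1 : ℝ) with hu
  have hun : ‖u‖ = 1 := by simp [hu]
  have hinner : ∀ z : 𝔼, ⟪z, u⟫_ℝ = z 0 := by
    intro z
    simp [hu, EuclideanSpace.inner_single_right]
  have hc0 : ∀ (x : 𝔼) (τ : ℝ), (x - τ • u) 0 = x 0 - τ := fun x τ => by simp [hu]
  have hc1 : ∀ (x : 𝔼) (τ : ℝ), (x - τ • u) 1 = x 1 := fun x τ => by simp [hu]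
  have hc2 : ∀ (x : 𝔼) (τ : ℝ), (x - τ • u) 2 = x 2 := fun x τ => by simp [hu]
  -- the second and third coordinates of a defect are in `E₂`, `E₃`
  have hdef : ∀ x : 𝔼, ¬ (x ∈ ω ↔ x ∈ ω') → x 1 ∈ E₂ ∧ x 2 ∈ E₃ := by
    intro x hx
    by_cases hxω : x ∈ ω
    · exact ⟨((hω x).1 hxω).2.1, ((hω x).1 hxω).2.2⟩
    · have hxω' : x ∈ ω' := by
        by_contra h'
        exact hx ⟨fun h => (hxω h).elim, fun h => (h' h).elim⟩
      obtain ⟨e, he, hea⟩ := hE₁' (a - r₁ - 1)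
      have hea' : e < a := by
        have := (abs_le.1 hea).2
        linarith
      set x' : 𝔼 := x - (x 0 - e) • u with hx'
      have hx'ω' : x' ∈ ω' := by
        rw [hω']
        refine ⟨?_, ?_, ?_⟩
        · rw [hx', hc0]
          simpa using he
        · rw [hx', hc1]
          exact ((hω' x).1 hxω').2.1
        · rw [hx', hc2]
          exact ((hω' x).1 hxω').2.2
      have hx'0 : x' 0 < a := by
        rw [hx', hc0]
        simpa using hea'
      have hx'ω : x' ∈ ω := (hagree x' hx'0).2 hx'ω'
      have h := (hω x').1 hx'ω
      rw [hx', hc1, hc2] at h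
      exact ⟨h.2.1, h.2.2⟩
  refine hbl_eq_of_thick_normal_lines _ _ _ hδ hsep hsep' hbal hbal' _ _ hun
    (fun z hz => hagree z (by rwa [hinner] at hz)) fun x hx => ?_
  obtain ⟨h1, h2⟩ := hdef x hx
  refine hbl_thick_of_bounded_gaps (L := 2 * r₁) (by positivity) fun T _ => ?_
  obtain ⟨e, he, heT⟩ := hE₁ (x 0 - T - r₁)
  obtain ⟨hlo, hhi⟩ := abs_le.1 heT
  refine ⟨x 0 - e, by linarith, by linarith, ?_⟩
  rw [hω, hc0, hc1, hc2]
  exact ⟨by simpa using he, h1, h2⟩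

end Summit.AtomisticToContinuum.Crystallization.Theorems.HolmgrenBoyleLind

end
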